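import Mathlib.RingTheory.Polynomial.Cyclotomic.Roots
import Mathlib.Algebra.Order.Field.Basic
import Literature.NumberTheory.LFunctions.DegreeOnePrimesPNT
import HarnessLib

/-!
# McCurley's Lemma 5 for fixed `n`: `∏_{p ≤ y} (p − 1)/(p − 1 + g_p(n)) ≪_n (log y)^{−d(n)}`

Topic `Literature/NumberTheory/Sieve`. Everything in this file is PROVED.

K. S. McCurley, *The smallest prime value of `xⁿ + a`*, Can. J. Math. 38 (1986), Lemma 5 (p. 930):
"There exists a positive constant `C₁₃` such that
`∏_{p ≤ y} (p − 1)/(p − 1 + (p − 1, n)) < exp(C₁₃ d(n) log n − d(n) log₂ y)` provided `y ≥ 2`",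
proved there from Norton's uniform Mertens theorem in progressions (Lemma 4). For the proof of
McCurley's Theorem 3 the degree `n` is FIXED, and we prove the fixed-`n` form

  `∏_{p ≤ y} (p − 1)/(p − 1 + g_p(n)) ≤ C(n)/(log y)^{d(n)}`   (`y ≥ 2`),

where `g_p(n) = #{x < p : xⁿ % p = 1}` is the number of `n`-th roots of unity modulo `p`
(`= (p − 1, n)`; the form used by `Literature.NumberTheory.Sieve.exists_powClasses_card_filter_le`)
and `d(n) = #(Nat.divisors n)`. The density input is the tree's Mertens theorem with rate for the
roots of a polynomial congruence (`Literature.NumberTheory.LFunctions.DegreeOnePrimes.sum_primesLE_rootCount_div_eq`,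
from the prime ideal theorem) applied to each cyclotomic factor `Φ_e`, `e ∣ n`: for `p ∤ n` the
roots of the `Φ_e (mod p)`, `e ∣ n`, are distinct `n`-th roots of unity (a root of `Φ_e (mod p)` is
a PRIMITIVE `e`-th root of unity, Mathlib's `Polynomial.isRoot_cyclotomic_iff`), so
`∑_{e ∣ n} ν_{Φ_e}(p) ≤ g_p(n)` and `∑_{p ≤ y} ν_{Φ_e}(p)/p = log₂ y + O_e(1)` for each of the
`d(n)` divisors gives `∑_{p ≤ y} g_p(n)/(p − 1 + g_p(n)) ≥ d(n) log₂ y − O_n(1)`.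

* `rootCount_cyclotomic_le_totient` : `ν_{Φ_e}(p) ≤ φ(e)`;
* `sum_divisors_rootCount_cyclotomic_le` : `∑_{e ∣ n} ν_{Φ_e}(p) ≤ g_p(n)` for `p ∤ n`;
* `loglog_sub_le_sum_primesLE_rootCount_cyclotomic_div` : `∑_{p ≤ y} ν_{Φ_e}(p)/p ≥ log₂ y − K_e`;
* `card_divisors_mul_loglog_sub_le` : `∑_{p ≤ y} g_p(n)/(p − 1 + g_p(n)) ≥ d(n) log₂ y − K`;
* `prod_primesLE_powClassFactor_le` : the displayed bound (McCurley's Lemma 5, fixed `n`).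

## References

* K. S. McCurley, Can. J. Math. 38 (1986) 925–936, Lemma 5 (p. 930). [McCurley1986SmallestPrimeValue]
-/

open Finset Polynomial

namespace Literature.NumberTheory.Sieve

/-! ### Roots of cyclotomic polynomials modulo `p` -/

/-- `ν_{Φ_e}(p) ≤ φ(e)`: the roots of `Φ_e` modulo a prime `p` inject into the roots of
`Φ_e ∈ (ℤ/p)[X]`, a non-zero polynomial of degree `φ(e)`. [folklore] -/
theorem rootCount_cyclotomic_le_totient {p : ℕ} (hp : p.Prime) (e : ℕ) :
    #((range p).filter fun m : ℕ => (p : ℤ) ∣ (cyclotomic e ℤ).eval (m : ℤ)) ≤ Nat.totient e := by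
  classical
  haveI := Fact.mk hp
  set Φ := cyclotomic e (ZMod p) with hΦ
  have hΦ0 : Φ ≠ 0 := cyclotomic_ne_zero e (ZMod p)
  have heval : ∀ m : ℕ, (p : ℤ) ∣ (cyclotomic e ℤ).eval (m : ℤ) → Φ.IsRoot (m : ZMod p) := by
    intro m hm
    rw [IsRoot.def, hΦ, ← map_cyclotomic_int, eval_natCast_map, eq_intCast,
      ZMod.intCast_zmod_eq_zero_iff_dvd]
    exact hm
  calc #((range p).filter fun m : ℕ => (p : ℤ) ∣ (cyclotomic e ℤ).eval (m : ℤ))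
      ≤ #Φ.roots.toFinset := by
        refine card_le_card_of_injOn (fun m => (m : ZMod p)) (fun m hm => ?_) ?_
        · rw [mem_coe, mem_filter] at hm
          rw [mem_coe, Multiset.mem_toFinset, mem_roots hΦ0]
          exact heval m hm.2
        · intro m hm m' hm' h
          rw [mem_coe, mem_filter, mem_range] at hm hm'
          have h' : m % p = m' % p := (ZMod.natCast_eq_natCast_iff' m m' p).1 h
          rwa [Nat.mod_eq_of_lt hm.1, Nat.mod_eq_of_lt hm'.1] at h'
    _ ≤ Multiset.card Φ.roots := Multiset.toFinset_card_le _
    _ ≤ Φ.natDegree := card_roots' Φ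
    _ = Nat.totient e := natDegree_cyclotomic e (ZMod p)

/-- **The roots of the `Φ_e (mod p)`, `e ∣ n`, are distinct `n`-th roots of unity** (`p ∤ n`):
`∑_{e ∣ n} ν_{Φ_e}(p) ≤ g_p(n) = #{x < p : xⁿ % p = 1}`. A root of `Φ_e` modulo `p ∤ e` is a
primitive `e`-th root of unity (`Polynomial.isRoot_cyclotomic_iff`), so the root sets for
distinct `e` are disjoint and consist of `x` with `xⁿ ≡ 1`. [folklore] -/
theorem sum_divisors_rootCount_cyclotomic_le {p n : ℕ} (hp : p.Prime) (hpn : ¬ p ∣ n) :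
    ∑ e ∈ n.divisors, #((range p).filter fun m : ℕ => (p : ℤ) ∣ (cyclotomic e ℤ).eval (m : ℤ)) ≤
      #((range p).filter fun x => x ^ n % p = 1) := by
  classical
  haveI := Fact.mk hp
  have hp2 := hp.two_le
  -- a root of `Φ_e (mod p)`, `e ∣ n`, is a primitive `e`-th root of unity in `ℤ/p`
  have hroot : ∀ e ∈ n.divisors, ∀ m : ℕ, (p : ℤ) ∣ (cyclotomic e ℤ).eval (m : ℤ) →
      IsPrimitiveRoot (m : ZMod p) e := by
    intro e he m hm
    have hed : e ∣ n := Nat.dvd_of_mem_divisors he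
    haveI : NeZero (e : ZMod p) := ⟨by
      rw [Ne, ZMod.natCast_eq_zero_iff]
      exact fun h => hpn (h.trans hed)⟩
    rw [← isRoot_cyclotomic_iff, IsRoot.def, ← map_cyclotomic_int, eval_natCast_map, eq_intCast,
      ZMod.intCast_zmod_eq_zero_iff_dvd]
    exact hm
  set N : ℕ → Finset ℕ := fun e => (range p).filter fun m : ℕ => (p : ℤ) ∣ (cyclotomic e ℤ).eval (m : ℤ)
    with hN
  -- pairwise disjoint
  have hdisj : ∀ e ∈ n.divisors, ∀ e' ∈ n.divisors, e ≠ e' → Disjoint (N e) (N e') := by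
    intro e he e' he' hne
    rw [disjoint_left]
    intro m hm hm'
    rw [hN, mem_filter] at hm hm'
    exact hne ((hroot e he m hm.2).unique (hroot e' he' m hm'.2))
  -- contained in the `n`-th roots of unity
  have hsub : (n.divisors).biUnion N ⊆ (range p).filter fun x => x ^ n % p = 1 := by
    intro m hm
    rw [mem_biUnion] at hm
    obtain ⟨e, he, hme⟩ := hm
    rw [hN, mem_filter] at hme
    have hed : e ∣ n := Nat.dvd_of_mem_divisors he
    have hprim := hroot e he m hme.2
    have hpow : ((m : ZMod p)) ^ n = 1 := by
      obtain ⟨k, rfl⟩ := hed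
      rw [pow_mul, hprim.pow_eq_one, one_pow]
    rw [mem_filter]
    refine ⟨hme.1, ?_⟩
    have h1 : ((m ^ n : ℕ) : ZMod p) = ((1 : ℕ) : ZMod p) := by push_cast; exact hpow
    rw [ZMod.natCast_eq_natCast_iff'] at h1
    rwa [Nat.mod_eq_of_lt (by omega : 1 < p)] at h1
  calc ∑ e ∈ n.divisors, #(N e) = #((n.divisors).biUnion N) := (card_biUnion hdisj).symm
    _ ≤ #((range p).filter fun x => x ^ n % p = 1) := card_le_card hsub

/-- `∑_{e ∣ n} ν_{Φ_e}(p) ≤ ∑_{e ∣ n} φ(e) = n` for every prime `p`. [folklore] -/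
theorem sum_divisors_rootCount_cyclotomic_le_self {p n : ℕ} (hp : p.Prime) :
    ∑ e ∈ n.divisors, #((range p).filter fun m : ℕ => (p : ℤ) ∣ (cyclotomic e ℤ).eval (m : ℤ)) ≤ n := by
  calc ∑ e ∈ n.divisors, #((range p).filter fun m : ℕ => (p : ℤ) ∣ (cyclotomic e ℤ).eval (m : ℤ))
      ≤ ∑ e ∈ n.divisors, Nat.totient e := sum_le_sum fun e _ => rootCount_cyclotomic_le_totient hp e
    _ = n := Nat.sum_totient n

/-! ### Mertens' theorem for the roots of `Φ_e` -/

/-- **Mertens for the roots of `Φ_e (mod p)`** (from the prime ideal theorem for `ℚ(ζ_e)`, through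
`Literature.NumberTheory.LFunctions.DegreeOnePrimes.sum_primesLE_rootCount_div_eq`): for `e ≥ 1` there is `K_e` with
`∑_{p ≤ y} ν_{Φ_e}(p)/p ≥ log log y − K_e` for all integers `y ≥ 2`. (This is the statement
"the primes `p ≡ 1 (mod e)` have density `1/φ(e)`" in Mertens form, Norton's lemma for `l = 1`
without uniformity in `e`.) [cite: McCurley1986SmallestPrimeValue, Lemma 4 (p. 929)] -/
theorem loglog_sub_le_sum_primesLE_rootCount_cyclotomic_div {e : ℕ} (he : 0 < e) :
    ∃ K : ℝ, ∀ y : ℕ, 2 ≤ y → Real.log (Real.log y) - K ≤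
      ∑ p ∈ Nat.primesLE y,
        (#((range p).filter fun m : ℕ => (p : ℤ) ∣ (cyclotomic e ℤ).eval (m : ℤ)) : ℝ) / p := by
  obtain ⟨c, C, h⟩ := Literature.NumberTheory.LFunctions.DegreeOnePrimes.sum_primesLE_rootCount_div_eq
    (cyclotomic.monic e ℤ) (cyclotomic.irreducible he) 0
  refine ⟨|c| + |C| / Real.log 2, fun y hy => ?_⟩
  have hy' : (2 : ℝ) ≤ y := by exact_mod_cast hy
  have h1 := h y hy'
  rw [Nat.floor_natCast, zero_add, pow_one] at h1
  have hlog2 : 0 < Real.log 2 := Real.log_pos one_lt_two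
  have hlog : Real.log 2 ≤ Real.log y := Real.log_le_log two_pos hy'
  have h2 := (abs_sub_le_iff.1 h1).2
  have h3 : C / Real.log y ≤ |C| / Real.log 2 :=
    calc C / Real.log y ≤ |C| / Real.log y :=
          div_le_div_of_nonneg_right (le_abs_self C) (by linarith)
      _ ≤ |C| / Real.log 2 := div_le_div_of_nonneg_left (abs_nonneg C) hlog2 hlog
  have h4 : -|c| ≤ c := neg_abs_le c
  linarith

/-! ### McCurley's Lemma 5 (fixed `n`) -/

/-- Elementary inequality: for `s ≥ 0` and `p > 1`, `s/p − s²/p² ≤ s/(p − 1 + s)`. [folklore] -/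
theorem div_sub_sq_div_sq_le_div {s p : ℝ} (hs : 0 ≤ s) (hp : 1 < p) :
    s / p - s ^ 2 / p ^ 2 ≤ s / (p - 1 + s) := by
  have hp0 : 0 < p := by linarith
  have hd : 0 < p - 1 + s := by linarith
  rw [div_sub_div _ _ hp0.ne' (pow_ne_zero 2 hp0.ne'), div_le_div_iff₀ (by positivity) hd]
  have h1 : 0 ≤ p - s + s ^ 2 := by nlinarith [sq_nonneg (s - 1 / 2)]
  have h2 : 0 ≤ s * p * (p - s + s ^ 2) := mul_nonneg (mul_nonneg hs hp0.le) h1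
  nlinarith [h2]

/-- Monotonicity of `g ↦ g/(p − 1 + g)` (`p ≥ 1`). [folklore] -/
theorem div_pred_add_self_mono {s g p : ℝ} (hs : 0 ≤ s) (hsg : s ≤ g) (hp : 1 ≤ p) :
    s / (p - 1 + s) ≤ g / (p - 1 + g) := by
  rcases eq_or_lt_of_le hs with rfl | hs0
  · rw [zero_div]
    exact div_nonneg (by linarith) (by linarith)
  · rw [div_le_div_iff₀ (by linarith) (by linarith)]
    nlinarith

/-- **The logarithmic form of Lemma 5 (fixed `n`).** For `n ≥ 1` there is `K` such that for all
integers `y ≥ 2`, `∑_{p ≤ y} g_p(n)/(p − 1 + g_p(n)) ≥ d(n) log log y − K`: on the primes `p ∤ n`,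
`g_p(n)/(p − 1 + g_p(n)) ≥ s_p/p − n²/p²` with `s_p = ∑_{e ∣ n} ν_{Φ_e}(p) ≤ n`
(`sum_divisors_rootCount_cyclotomic_le`), and `∑_{p ≤ y} s_p/p ≥ d(n) log log y − ∑_e K_e`
(`loglog_sub_le_sum_primesLE_rootCount_cyclotomic_div`); the primes dividing `n` and `∑ 1/p²`
cost `O_n(1)`. [cite: McCurley1986SmallestPrimeValue, Lemma 5 (pp. 930–931)] -/
theorem card_divisors_mul_loglog_sub_le {n : ℕ} (hn : 1 ≤ n) :
    ∃ K : ℝ, ∀ y : ℕ, 2 ≤ y →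
      (#n.divisors : ℝ) * Real.log (Real.log y) - K ≤
        ∑ p ∈ Nat.primesLE y, (#((range p).filter fun x => x ^ n % p = 1) : ℝ) /
          ((p : ℝ) - 1 + #((range p).filter fun x => x ^ n % p = 1)) := by
  classical
  have hK : ∀ e ∈ n.divisors, ∃ K : ℝ, ∀ y : ℕ, 2 ≤ y → Real.log (Real.log y) - K ≤
      ∑ p ∈ Nat.primesLE y,
        (#((range p).filter fun m : ℕ => (p : ℤ) ∣ (cyclotomic e ℤ).eval (m : ℤ)) : ℝ) / p :=
    fun e he => loglog_sub_le_sum_primesLE_rootCount_cyclotomic_div (Nat.pos_of_mem_divisors he)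
  choose! K hK using hK
  refine ⟨∑ e ∈ n.divisors, K e + (n : ℝ) ^ 2 + (n : ℝ) ^ 2, fun y hy => ?_⟩
  -- notation
  set ν : ℕ → ℕ → ℕ := fun e p => #((range p).filter fun m : ℕ => (p : ℤ) ∣ (cyclotomic e ℤ).eval (m : ℤ))
    with hν
  set g : ℕ → ℕ := fun p => #((range p).filter fun x => x ^ n % p = 1) with hg
  set s : ℕ → ℕ := fun p => ∑ e ∈ n.divisors, ν e p with hs
  set P := Nat.primesLE y with hP
  set A := P.filter fun p => ¬ p ∣ n with hA
  set B := P.filter fun p => p ∣ n with hB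
  have hPprime : ∀ p ∈ P, p.Prime := fun p hp => (Nat.mem_primesLE.1 hp).2
  have hn0 : (0 : ℝ) < n := by exact_mod_cast hn
  -- (1) the cyclotomic Mertens bounds, summed over `e ∣ n`
  have h1 : (#n.divisors : ℝ) * Real.log (Real.log y) - ∑ e ∈ n.divisors, K e ≤
      ∑ p ∈ P, (s p : ℝ) / p := by
    have : ∑ p ∈ P, (s p : ℝ) / p = ∑ e ∈ n.divisors, ∑ p ∈ P, (ν e p : ℝ) / p := by
      rw [sum_comm]
      refine sum_congr rfl fun p _ => ?_
      rw [hs]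
      push_cast
      rw [sum_div]
    rw [this, card_eq_sum_ones, Nat.cast_sum, sum_mul, ← sum_sub_distrib]
    refine sum_le_sum fun e he => ?_
    simpa using hK e he y hy
  -- (2) the primes dividing `n` contribute at most `n²`
  have h2 : ∑ p ∈ B, (s p : ℝ) / p ≤ (n : ℝ) ^ 2 := by
    have hBsub : B ⊆ Icc 1 n := by
      intro p hp
      rw [hB, mem_filter] at hp
      rw [mem_Icc]
      exact ⟨(hPprime p hp.1).one_le, Nat.le_of_dvd (by omega) hp.2⟩
    calc ∑ p ∈ B, (s p : ℝ) / p ≤ ∑ _p ∈ B, (n : ℝ) := by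
          refine sum_le_sum fun p hp => ?_
          have hp' := hPprime p (mem_filter.1 hp).1
          have hsp : (s p : ℝ) ≤ n := by exact_mod_cast sum_divisors_rootCount_cyclotomic_le_self hp'
          have hp1 : (1 : ℝ) ≤ p := by exact_mod_cast hp'.one_le
          calc (s p : ℝ) / p ≤ s p := div_le_self (Nat.cast_nonneg _) hp1
            _ ≤ n := hsp
      _ = #B * (n : ℝ) := by rw [sum_const, nsmul_eq_mul]
      _ ≤ n * n := by
          have : (#B : ℝ) ≤ n := by
            have := card_le_card hBsub
            rw [Nat.card_Icc] at this
            exact_mod_cast (by omega : #B ≤ n)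
          exact mul_le_mul_of_nonneg_right this hn0.le
      _ = (n : ℝ) ^ 2 := by ring
  have hsplit : ∑ p ∈ P, (s p : ℝ) / p = ∑ p ∈ A, (s p : ℝ) / p + ∑ p ∈ B, (s p : ℝ) / p := by
    rw [hA, hB, ← sum_filter_add_sum_filter_not P (fun p => p ∣ n), add_comm]
  -- (3) on `A`: `g/(p-1+g) ≥ s/p - n²/p²`
  have h3 : ∀ p ∈ A, (s p : ℝ) / p - (n : ℝ) ^ 2 * ((p : ℝ) ^ 2)⁻¹ ≤
      (g p : ℝ) / ((p : ℝ) - 1 + g p) := by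
    intro p hp
    rw [hA, mem_filter] at hp
    have hp' := hPprime p hp.1
    have hp1 : (1 : ℝ) ≤ p := by exact_mod_cast hp'.one_le
    have hp1' : (1 : ℝ) < p := by exact_mod_cast hp'.one_lt
    have hs0 : (0 : ℝ) ≤ s p := Nat.cast_nonneg _
    have hsg : (s p : ℝ) ≤ g p := by exact_mod_cast sum_divisors_rootCount_cyclotomic_le hp' hp.2
    have hsn : (s p : ℝ) ≤ n := by exact_mod_cast sum_divisors_rootCount_cyclotomic_le_self hp'
    have hsq : (s p : ℝ) ^ 2 / (p : ℝ) ^ 2 ≤ (n : ℝ) ^ 2 * ((p : ℝ) ^ 2)⁻¹ := by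
      rw [← div_eq_mul_inv]
      exact div_le_div_of_nonneg_right (pow_le_pow_left₀ hs0 hsn 2) (by positivity)
    calc (s p : ℝ) / p - (n : ℝ) ^ 2 * ((p : ℝ) ^ 2)⁻¹ ≤ (s p : ℝ) / p - (s p : ℝ) ^ 2 / (p : ℝ) ^ 2 := by
          linarith
      _ ≤ (s p : ℝ) / ((p : ℝ) - 1 + s p) := div_sub_sq_div_sq_le_div hs0 hp1'
      _ ≤ (g p : ℝ) / ((p : ℝ) - 1 + g p) := div_pred_add_self_mono hs0 hsg hp1
  have h4 : ∑ p ∈ A, ((s p : ℝ) / p - (n : ℝ) ^ 2 * ((p : ℝ) ^ 2)⁻¹) ≤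
      ∑ p ∈ P, (g p : ℝ) / ((p : ℝ) - 1 + g p) := by
    calc ∑ p ∈ A, ((s p : ℝ) / p - (n : ℝ) ^ 2 * ((p : ℝ) ^ 2)⁻¹)
        ≤ ∑ p ∈ A, (g p : ℝ) / ((p : ℝ) - 1 + g p) := sum_le_sum h3
      _ ≤ ∑ p ∈ P, (g p : ℝ) / ((p : ℝ) - 1 + g p) := by
          refine sum_le_sum_of_subset_of_nonneg (filter_subset _ _) fun p hp _ => ?_
          have hp1 : (1 : ℝ) ≤ p := by exact_mod_cast (hPprime p hp).one_le
          exact div_nonneg (Nat.cast_nonneg _) (by linarith [(Nat.cast_nonneg (g p) : (0:ℝ) ≤ _)])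
  -- `∑_{p ≤ y} 1/p² ≤ ∑_{1 < i ≤ y} 1/i² ≤ 1` (as in `FriedlanderIwaniecPrimes.sum_primesLE_inv_sq_le_one`)
  have hsq1 : ∑ p ∈ P, ((p : ℝ) ^ 2)⁻¹ ≤ 1 := by
    have hsub : P ⊆ Ioo 1 (y + 1) := by
      intro p hp
      have hp' := Nat.mem_primesLE.1 hp
      exact mem_Ioo.2 ⟨hp'.2.one_lt, Nat.lt_succ_of_le hp'.1⟩
    calc ∑ p ∈ P, ((p : ℝ) ^ 2)⁻¹ ≤ ∑ p ∈ Ioo 1 (y + 1), ((p : ℝ) ^ 2)⁻¹ :=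
          sum_le_sum_of_subset_of_nonneg hsub fun p _ _ => by positivity
      _ ≤ 2 / ((1 : ℕ) + 1) := sum_Ioo_inv_sq_le 1 (y + 1)
      _ = 1 := by norm_num
  have h5 : ∑ p ∈ A, (n : ℝ) ^ 2 * ((p : ℝ) ^ 2)⁻¹ ≤ (n : ℝ) ^ 2 := by
    rw [← mul_sum]
    calc (n : ℝ) ^ 2 * ∑ p ∈ A, ((p : ℝ) ^ 2)⁻¹ ≤ (n : ℝ) ^ 2 * ∑ p ∈ P, ((p : ℝ) ^ 2)⁻¹ := by
          refine mul_le_mul_of_nonneg_left ?_ (by positivity)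
          exact sum_le_sum_of_subset_of_nonneg (filter_subset _ _) fun p _ _ => by positivity
      _ ≤ (n : ℝ) ^ 2 * 1 := mul_le_mul_of_nonneg_left hsq1 (by positivity)
      _ = (n : ℝ) ^ 2 := mul_one _
  rw [sum_sub_distrib] at h4
  linarith

/-- **McCurley's Lemma 5 (fixed `n`).** For `n ≥ 1` there is `C > 0` such that for all integers
`y ≥ 2`, `∏_{p ≤ y} (p − 1)/(p − 1 + g_p(n)) ≤ C/(log y)^{d(n)}`, where
`g_p(n) = #{x < p : xⁿ % p = 1}` (`= (p − 1, n)`) and `d(n)` is the number of divisors of `n`.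
(McCurley: `< exp(C₁₃ d(n) log n − d(n) log₂ y)`, uniformly in `n`; here `n` is fixed and the
constant is inexplicit.) [cite: McCurley1986SmallestPrimeValue, Lemma 5 (p. 930)] -/
theorem prod_primesLE_powClassFactor_le {n : ℕ} (hn : 1 ≤ n) :
    ∃ C : ℝ, 0 < C ∧ ∀ y : ℕ, 2 ≤ y →
      ∏ p ∈ Nat.primesLE y,
          ((p : ℝ) - 1) / ((p : ℝ) - 1 + #((range p).filter fun x => x ^ n % p = 1)) ≤
        C / Real.log y ^ #n.divisors := by
  obtain ⟨K, hK⟩ := card_divisors_mul_loglog_sub_le hn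
  refine ⟨Real.exp K, Real.exp_pos K, fun y hy => ?_⟩
  set g : ℕ → ℕ := fun p => #((range p).filter fun x => x ^ n % p = 1) with hg
  have hy' : (2 : ℝ) ≤ y := by exact_mod_cast hy
  have hlog : 0 < Real.log y := Real.log_pos (by linarith)
  have hPprime : ∀ p ∈ Nat.primesLE y, p.Prime := fun p hp => (Nat.mem_primesLE.1 hp).2
  -- each factor is `1 - t_p ≤ exp (-t_p)`
  have hfac : ∀ p ∈ Nat.primesLE y, ((p : ℝ) - 1) / ((p : ℝ) - 1 + g p) ≤
      Real.exp (-((g p : ℝ) / ((p : ℝ) - 1 + g p))) := by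
    intro p hp
    have hp1 : (1 : ℝ) ≤ p := by exact_mod_cast (hPprime p hp).one_le
    have hg1 : (1 : ℝ) ≤ g p := by
      have h2 := (hPprime p hp).two_le
      have : 1 ≤ g p := card_pos.2 ⟨1, mem_filter.2 ⟨mem_range.2 (by omega),
        by rw [one_pow, Nat.mod_eq_of_lt (by omega)]⟩⟩
      exact_mod_cast this
    have hd : (p : ℝ) - 1 + g p ≠ 0 := by linarith
    have : ((p : ℝ) - 1) / ((p : ℝ) - 1 + g p) = 1 - (g p : ℝ) / ((p : ℝ) - 1 + g p) := by
      field_simp; ring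
    rw [this]
    exact Real.one_sub_le_exp_neg _
  have hnonneg : ∀ p ∈ Nat.primesLE y, 0 ≤ ((p : ℝ) - 1) / ((p : ℝ) - 1 + g p) := by
    intro p hp
    have hp1 : (1 : ℝ) ≤ p := by exact_mod_cast (hPprime p hp).one_le
    exact div_nonneg (by linarith) (by linarith [(Nat.cast_nonneg (g p) : (0 : ℝ) ≤ _)])
  calc ∏ p ∈ Nat.primesLE y, ((p : ℝ) - 1) / ((p : ℝ) - 1 + g p)
      ≤ ∏ p ∈ Nat.primesLE y, Real.exp (-((g p : ℝ) / ((p : ℝ) - 1 + g p))) :=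
        prod_le_prod hnonneg hfac
    _ = Real.exp (-∑ p ∈ Nat.primesLE y, (g p : ℝ) / ((p : ℝ) - 1 + g p)) := by
        rw [← Real.exp_sum, sum_neg_distrib]
    _ ≤ Real.exp (-((#n.divisors : ℝ) * Real.log (Real.log y) - K)) :=
        Real.exp_le_exp.2 (neg_le_neg (hK y hy))
    _ = Real.exp K / Real.log y ^ #n.divisors := by
        rw [neg_sub, Real.exp_sub, Real.exp_nat_mul, Real.exp_log hlog]

end Literature.NumberTheory.Sieve
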